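import Literature.NumberTheory.BeurlingPrimes.IntCountBasic
import HarnessLib

/-!
# From explicit asymptotics to the exponents of an `[α, β]`-system

Topic `Literature/NumberTheory/BeurlingPrimes`. Everything in this file is PROVED. It is the real-variable
glue used to read off the clauses of `BeurlingPrimes.IsSystem α β` (Hilberdink 2005 / Broucke–Debruyne–Révész
2023: `N_P(x) = ax + O_ε(x^{β+ε})`, `ψ_P(x) = x + O_ε(x^{α+ε})` "for every `ε > 0` but for no `ε < 0`")
from two-term expansions such as those of BDR Theorem 3.2:

* `intErrorLE_of_forall_ge`, `primeErrorLE_of_forall_ge` — an eventual bound `|N_P(x) − ax| ≤ C x^γ`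
  (`x ≥ X`, `γ ≥ 0`) is a bound on `[1, ∞)` (the counting functions are monotone, `x^γ ≥ 1`);
* `exp_mul_log_rpow_le` — `exp(c (log x)^{2/3}) ≤ D_ε x^ε` on `[1, ∞)`, so BV/BDR's remainder
  `x^{1/2} exp(c (log x)^{2/3})` is `O(x^{1/2+ε})`;
* `not_errorBound_of_mainTerm` — if `E(x) = b x^β + O(x^γ)` with `b ≠ 0`, `γ < β`, then `|E(x)| ≤ C x^{β−ε}`
  on `[1,∞)` fails for every `ε > 0` ("and not better", BDR §3);
* `not_intErrorLE_of_frequently` — an `Ω`-estimate `|N_P(x) − ax| ≥ c x^γ` infinitely often excludes every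
  exponent `γ' < γ`;
* `not_intErrorLE_of_hilberdink` — BDR's use of Hilberdink's uncertainty principle in Corollary 3.4: if the
  primes of `P` have exact exponent `α < 1/2`, then `N_P(x) − ax ≪ x^{1/2−ε}` cannot hold (given
  `Literature.Barriers.RiemannHypothesis.Hilberdink2005_thm1`), the intermediate exponent being
  `β' = inf{γ : N_P(x) − ax ≪ x^γ}`.

## References
* [BrouckeDebruyneRevesz2023] F. Broucke, G. Debruyne, Sz. Gy. Révész, *Some examples of well-behaved Beurling
  number systems*, arXiv:2309.01567, §1 (definition of `[α,β]`-systems), proofs of Corollaries 3.3–3.4.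
* [Hilberdink2005] T. W. Hilberdink, *Well-behaved Beurling primes and integers*, J. Number Theory 112 (2005)
  332–344, Theorem 1.
-/

noncomputable section

open Filter Set
open scoped Topology

namespace Literature.NumberTheory.BeurlingPrimes

open Literature.Barriers.RiemannHypothesis

variable (P : BeurlingPrimes)

/-! ### Eventual bounds are global bounds -/

/-- If `|N_P(x) − ax| ≤ C x^γ` for `x ≥ X` (`γ ≥ 0`) then `N_P(x) = ax + O(x^γ)` on `[1, ∞)`
(`N_P` is monotone, so bounded on `[1, X]`, where `x^γ ≥ 1`). [folklore] -/
theorem _root_.Literature.Barriers.RiemannHypothesis.BeurlingPrimes.intErrorLE_of_forall_ge {a γ X C : ℝ}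
    (hγ : 0 ≤ γ) (h : ∀ x : ℝ, X ≤ x → |(P.intCount x : ℝ) - a * x| ≤ C * x ^ γ) : P.IntErrorLE a γ := by
  set X' := max X 1 with hX'
  refine ⟨max C (P.intCount X' + |a| * X'), fun x hx ↦ ?_⟩
  have hxγ : 1 ≤ x ^ γ := Real.one_le_rpow hx hγ
  rcases le_or_gt X' x with hXx | hxX
  · exact (h x ((le_max_left _ _).trans hXx)).trans
      (mul_le_mul_of_nonneg_right (le_max_left _ _) (zero_le_one.trans hxγ))
  · have h1 : (P.intCount x : ℝ) ≤ P.intCount X' := by exact_mod_cast P.intCount_mono hxX.le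
    have h2 : |a * x| ≤ |a| * X' := by
      rw [abs_mul]
      exact mul_le_mul_of_nonneg_left (by rw [abs_of_nonneg (by linarith)]; exact hxX.le) (abs_nonneg a)
    have h3 : |(P.intCount x : ℝ) - a * x| ≤ P.intCount X' + |a| * X' := by
      refine (abs_sub _ _).trans ?_
      rw [Nat.abs_cast]
      linarith
    calc |(P.intCount x : ℝ) - a * x| ≤ (P.intCount X' + |a| * X') * 1 := by rw [mul_one]; exact h3
      _ ≤ max C (P.intCount X' + |a| * X') * x ^ γ :=
        mul_le_mul (le_max_right _ _) hxγ zero_le_one ((by positivity : (0 : ℝ) ≤ _).trans (le_max_right _ _))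

/-- If `|ψ_P(x) − x| ≤ C x^γ` for `x ≥ X` (`γ ≥ 0`) then `ψ_P(x) = x + O(x^γ)` on `[1, ∞)`. [folklore] -/
theorem _root_.Literature.Barriers.RiemannHypothesis.BeurlingPrimes.primeErrorLE_of_forall_ge {γ X C : ℝ}
    (hγ : 0 ≤ γ) (h : ∀ x : ℝ, X ≤ x → |P.chebyshevPsi x - x| ≤ C * x ^ γ) : P.PrimeErrorLE γ := by
  set X' := max X 1 with hX'
  refine ⟨max C (P.chebyshevPsi X' + X'), fun x hx ↦ ?_⟩
  have hxγ : 1 ≤ x ^ γ := Real.one_le_rpow hx hγ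
  rcases le_or_gt X' x with hXx | hxX
  · exact (h x ((le_max_left _ _).trans hXx)).trans
      (mul_le_mul_of_nonneg_right (le_max_left _ _) (zero_le_one.trans hxγ))
  · have h1 : P.chebyshevPsi x ≤ P.chebyshevPsi X' := P.chebyshevPsi_mono hxX.le
    have h0 : 0 ≤ P.chebyshevPsi x := P.chebyshevPsi_nonneg x
    have h3 : |P.chebyshevPsi x - x| ≤ P.chebyshevPsi X' + X' := by
      rw [abs_le]; constructor <;> linarith
    calc |P.chebyshevPsi x - x| ≤ (P.chebyshevPsi X' + X') * 1 := by rw [mul_one]; exact h3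
      _ ≤ max C (P.chebyshevPsi X' + X') * x ^ γ :=
        mul_le_mul (le_max_right _ _) hxγ zero_le_one
          ((by linarith [P.chebyshevPsi_nonneg X'] : (0 : ℝ) ≤ _).trans (le_max_right _ _))

/-! ### The remainder `x^{1/2} exp(c (log x)^{2/3})` -/

/-- `exp(c (log x)^{2/3}) ≤ D x^ε` on `[1, ∞)` for every `ε > 0` (with `D = exp(c L₀^{2/3})`, `L₀ = (c/ε)^3`:
for `log x ≥ L₀` already `c (log x)^{2/3} ≤ ε log x`). [folklore] -/
theorem exp_mul_log_rpow_le {c ε : ℝ} (hc : 0 < c) (hε : 0 < ε) :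
    ∃ D : ℝ, 0 < D ∧ ∀ x : ℝ, 1 ≤ x → Real.exp (c * Real.log x ^ (2 / 3 : ℝ)) ≤ D * x ^ ε := by
  set L₀ : ℝ := (c / ε) ^ (3 : ℕ) with hL₀
  have hL₀0 : 0 ≤ L₀ := by positivity
  refine ⟨Real.exp (c * L₀ ^ (2 / 3 : ℝ)), Real.exp_pos _, fun x hx ↦ ?_⟩
  have hL : 0 ≤ Real.log x := Real.log_nonneg hx
  have hxε : 1 ≤ x ^ ε := Real.one_le_rpow hx hε.le
  rcases le_or_gt L₀ (Real.log x) with hle | hlt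
  · -- `c L^{2/3} ≤ ε L`, so `exp(c L^{2/3}) ≤ x^ε ≤ D x^ε`
    have h1 : c / ε ≤ Real.log x ^ (1 / 3 : ℝ) := by
      have h13 : L₀ ^ (1 / 3 : ℝ) = c / ε := by
        rw [hL₀, show (1 / 3 : ℝ) = ((3 : ℕ) : ℝ)⁻¹ by norm_num,
          Real.pow_rpow_inv_natCast (by positivity) (by norm_num)]
      rw [← h13]
      exact Real.rpow_le_rpow hL₀0 hle (by norm_num)
    have h2 : c * Real.log x ^ (2 / 3 : ℝ) ≤ ε * Real.log x := by
      have h3 : Real.log x = Real.log x ^ (2 / 3 : ℝ) * Real.log x ^ (1 / 3 : ℝ) := by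
        rw [← Real.rpow_add' hL (by norm_num)]; norm_num
      have h4 : 0 ≤ Real.log x ^ (2 / 3 : ℝ) := Real.rpow_nonneg hL _
      calc c * Real.log x ^ (2 / 3 : ℝ) = Real.log x ^ (2 / 3 : ℝ) * (ε * (c / ε)) := by
            field_simp
        _ ≤ Real.log x ^ (2 / 3 : ℝ) * (ε * Real.log x ^ (1 / 3 : ℝ)) := by gcongr
        _ = ε * (Real.log x ^ (2 / 3 : ℝ) * Real.log x ^ (1 / 3 : ℝ)) := by ring
        _ = ε * Real.log x := by rw [← h3]
    calc Real.exp (c * Real.log x ^ (2 / 3 : ℝ)) ≤ Real.exp (ε * Real.log x) := Real.exp_le_exp.mpr h2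
      _ = x ^ ε := by rw [Real.rpow_def_of_pos (by linarith), mul_comm]
      _ ≤ Real.exp (c * L₀ ^ (2 / 3 : ℝ)) * x ^ ε :=
        le_mul_of_one_le_left (zero_le_one.trans hxε) (Real.one_le_exp_iff.mpr (by positivity))
  · -- `L < L₀`: `exp(c L^{2/3}) ≤ exp(c L₀^{2/3}) = D ≤ D x^ε`
    calc Real.exp (c * Real.log x ^ (2 / 3 : ℝ)) ≤ Real.exp (c * L₀ ^ (2 / 3 : ℝ)) := by
          gcongr
        _ ≤ Real.exp (c * L₀ ^ (2 / 3 : ℝ)) * x ^ ε := le_mul_of_one_le_right (Real.exp_pos _).le hxε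

/-- The BV/BDR remainder is `O(x^{1/2+ε})`: `x^{1/2} exp(c (log x)^{2/3}) ≤ D x^{1/2+ε}` on `[1, ∞)`. [folklore] -/
theorem sqrt_mul_exp_log_rpow_le {c ε : ℝ} (hc : 0 < c) (hε : 0 < ε) :
    ∃ D : ℝ, 0 < D ∧ ∀ x : ℝ, 1 ≤ x →
      x ^ (1 / 2 : ℝ) * Real.exp (c * Real.log x ^ (2 / 3 : ℝ)) ≤ D * x ^ (1 / 2 + ε) := by
  obtain ⟨D, hD, h⟩ := exp_mul_log_rpow_le hc hε
  refine ⟨D, hD, fun x hx ↦ ?_⟩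
  rw [Real.rpow_add (by linarith), mul_left_comm]
  exact mul_le_mul_of_nonneg_left (h x hx) (Real.rpow_nonneg (by linarith) _)

/-! ### Main terms exclude smaller exponents -/

/-- **"And not better"**: if `|E(x) − b x^β| ≤ K x^γ` for `x ≥ X` with `b ≠ 0` and `γ < β`, then for no
`ε > 0` and no `C` does `|E(x)| ≤ C x^{β−ε}` hold on `[1, ∞)`. [folklore] -/
theorem not_errorBound_of_mainTerm {E : ℝ → ℝ} {b β γ X K : ℝ} (hb : b ≠ 0) (hγ : γ < β)
    (hE : ∀ x : ℝ, X ≤ x → |E x - b * x ^ β| ≤ K * x ^ γ) {ε : ℝ} (hε : 0 < ε) :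
    ¬ ∃ C : ℝ, ∀ x : ℝ, 1 ≤ x → |E x| ≤ C * x ^ (β - ε) := by
  rintro ⟨C, hC⟩
  have hb2 : 0 < |b| / 2 := by positivity
  obtain ⟨x, hx1, hxX, h1, h2⟩ : ∃ x : ℝ, 1 ≤ x ∧ X ≤ x ∧ C * x ^ (-ε) < |b| / 2 ∧ K * x ^ (γ - β) < |b| / 2 :=
    ((eventually_ge_atTop 1).and ((eventually_ge_atTop X).and
      ((eventually_const_mul_rpow_lt (by linarith) C hb2).and
        (eventually_const_mul_rpow_lt (by linarith) K hb2)))).exists |>.imp fun _ h ↦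
          ⟨h.1, h.2.1, h.2.2.1, h.2.2.2⟩
  have hx0 : 0 < x := by linarith
  have hxβ : 0 < x ^ β := Real.rpow_pos_of_pos hx0 β
  have h3 : C * x ^ (β - ε) < |b| / 2 * x ^ β := by
    rw [sub_eq_add_neg, Real.rpow_add hx0, mul_comm (x ^ β), ← mul_assoc]
    exact mul_lt_mul_of_pos_right h1 hxβ
  have h4 : K * x ^ γ < |b| / 2 * x ^ β := by
    have : x ^ γ = x ^ (γ - β) * x ^ β := by rw [← Real.rpow_add hx0]; ring_nf
    rw [this, ← mul_assoc]
    exact mul_lt_mul_of_pos_right h2 hxβ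
  have h5 : |b| * x ^ β ≤ |E x| + K * x ^ γ := by
    have := abs_sub_abs_le_abs_sub (b * x ^ β) (E x)
    rw [abs_sub_comm] at this
    rw [abs_mul, abs_of_pos hxβ] at this
    linarith [hE x hxX]
  linarith [hC x hx1]

/-- Prime version: `ψ_P(x) − x = b x^β + O(x^γ)` (`x ≥ X`, `b ≠ 0`, `γ < β`) excludes `PrimeErrorLE (β − ε)`.
[cite: BrouckeDebruyneRevesz2023, proof of Corollary 3.3] -/
theorem _root_.Literature.Barriers.RiemannHypothesis.BeurlingPrimes.not_primeErrorLE_of_mainTerm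
    {b β γ X K : ℝ} (hb : b ≠ 0) (hγ : γ < β)
    (hE : ∀ x : ℝ, X ≤ x → |P.chebyshevPsi x - x - b * x ^ β| ≤ K * x ^ γ) {ε : ℝ} (hε : 0 < ε) :
    ¬ P.PrimeErrorLE (β - ε) :=
  not_errorBound_of_mainTerm (E := fun x ↦ P.chebyshevPsi x - x) hb hγ hE hε

/-- Integer version: `N_P(x) − ax = b x^β + O(x^γ)` (`x ≥ X`, `b ≠ 0`, `γ < β`) excludes `IntErrorLE a (β − ε)`.
[cite: BrouckeDebruyneRevesz2023, proof of Corollary 3.3] -/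
theorem _root_.Literature.Barriers.RiemannHypothesis.BeurlingPrimes.not_intErrorLE_of_mainTerm
    {a b β γ X K : ℝ} (hb : b ≠ 0) (hγ : γ < β)
    (hE : ∀ x : ℝ, X ≤ x → |(P.intCount x : ℝ) - a * x - b * x ^ β| ≤ K * x ^ γ) {ε : ℝ} (hε : 0 < ε) :
    ¬ P.IntErrorLE a (β - ε) :=
  not_errorBound_of_mainTerm (E := fun x ↦ (P.intCount x : ℝ) - a * x) hb hγ hE hε

/-- An `Ω`-estimate excludes smaller exponents: if `|N_P(x) − ax| ≥ c x^γ` for arbitrarily large `x`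
(`c > 0`), then `IntErrorLE a γ'` fails for every `γ' < γ`. [folklore] -/
theorem _root_.Literature.Barriers.RiemannHypothesis.BeurlingPrimes.not_intErrorLE_of_frequently {a c γ γ' : ℝ}
    (hc : 0 < c) (h : ∃ᶠ x : ℝ in atTop, c * x ^ γ ≤ |(P.intCount x : ℝ) - a * x|) (hγ' : γ' < γ) :
    ¬ P.IntErrorLE a γ' := by
  rintro ⟨C, hC⟩
  have hev : ∀ᶠ x : ℝ in atTop, ¬ c * x ^ γ ≤ |(P.intCount x : ℝ) - a * x| := by
    filter_upwards [eventually_ge_atTop 1, eventually_const_mul_rpow_lt (show γ' - γ < 0 by linarith) C hc]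
      with x hx h1
    have hx0 : 0 < x := by linarith
    have h2 : C * x ^ γ' < c * x ^ γ := by
      have : x ^ γ' = x ^ (γ' - γ) * x ^ γ := by rw [← Real.rpow_add hx0]; ring_nf
      rw [this, ← mul_assoc]
      exact mul_lt_mul_of_pos_right h1 (Real.rpow_pos_of_pos hx0 γ)
    exact not_le.mpr (lt_of_le_of_lt (hC x hx) h2)
  exact (h.and_eventually hev).exists.elim fun x hx ↦ hx.2 hx.1

/-! ### Hilberdink's uncertainty principle caps the integers when `α < 1/2` -/

/-- **BDR's use of Hilberdink's theorem (proof of Corollary 3.4)**: let the primes of `P` have exact exponent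
`α ∈ [0, 1/2)` and let `a > 0`. If `N_P(x) = ax + O(x^{1/2−ε})` on `[1, ∞)` for some `ε > 0`, then with
`β' := inf{γ : N_P(x) = ax + O(x^γ)} ∈ [0, 1/2 − ε]` the system is an `[α, β']`-system with
`max{α, β'} < 1/2`, contradicting `Hilberdink2005_thm1`. [cite: BrouckeDebruyneRevesz2023, proof of Corollary 3.4] -/
theorem _root_.Literature.Barriers.RiemannHypothesis.BeurlingPrimes.not_intErrorLE_of_hilberdink
    (hH : Hilberdink2005_thm1) {α a : ℝ} (hα0 : 0 ≤ α) (hα : α < 1 / 2) (ha : 0 < a)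
    (hpu : ∀ ε : ℝ, 0 < ε → P.PrimeErrorLE (α + ε)) (hpl : ∀ ε : ℝ, 0 < ε → ¬ P.PrimeErrorLE (α - ε))
    {ε : ℝ} (hε : 0 < ε) : ¬ P.IntErrorLE a (1 / 2 - ε) := by
  intro hI
  set T : Set ℝ := {γ : ℝ | P.IntErrorLE a γ} with hT
  have hne : T.Nonempty := ⟨_, hI⟩
  have hbdd : BddBelow T := ⟨0, fun γ hγ ↦ not_lt.mp fun hneg ↦ P.not_intErrorLE_of_neg hneg hγ⟩
  have h0 : ∀ γ ∈ T, 0 ≤ γ := fun γ hγ ↦ not_lt.mp fun hneg ↦ P.not_intErrorLE_of_neg hneg hγ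
  set β' := sInf T with hβ'
  have hβ'0 : 0 ≤ β' := le_csInf hne h0
  have hβ'le : β' ≤ 1 / 2 - ε := csInf_le hbdd hI
  have hsys : P.IsSystem α β' := by
    refine ⟨hα0, by linarith, hβ'0, by linarith, a, ha, fun ε' hε' ↦ ?_, fun ε' hε' hI' ↦ ?_, hpu, hpl⟩
    · obtain ⟨γ, hγT, hγlt⟩ := exists_lt_of_csInf_lt hne (show sInf T < β' + ε' by linarith)
      exact BeurlingPrimes.IntErrorLE.of_le P hγT hγlt.le
    · have : sInf T ≤ β' - ε' := csInf_le hbdd hI'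
      linarith
  have := hH P α β' hsys
  rcases le_max_iff.mp this with h1 | h1 <;> linarith

end Literature.NumberTheory.BeurlingPrimes
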